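import Literature.Probability.Percolation.InterfaceTraversalBound
import Literature.Probability.LatticeModels.MedialInterfaceProofs
import HarnessLib

/-!
# No boundary tracing for line `hitting-tournament` of crux `LagHandOff`
(stmt-CriticalPhenomena-10268), part 1/3: one visit near a boundary point forces an arm

Helper for the registered stub `stub_limitCurveRegularity` (conjunct (2), a.s. no boundary
tracing) of namespace `Summit.CriticalPhenomena.CardyFormulaZ2.Cruxes.LagHandOff.HittingTournament`;
this part proves the registered sub-stub `stub_noTrace_armOfVisit` (= `arm_of_visit` below).

DISCRETE INPUT, deterministic, for general discrete Dobrushin data `D'` (every `ω`): if the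
exploration polygon traverses a shell `D(x; ρ, R)` and no left vertex (resp. no corner of a right
face) of the darts traversed in between lies on the discrete arc `A` (resp. `B`), the chain of
left vertices (resp. right faces) is untainted by the boundary conditions, i.e. an OPEN ARM OF
`ω` itself across `A(x; ρ + δ, R - δ)` (resp. an `ω`-CLOSED ARM across `A(x; ρ + 3δ, R - 3δ)`)
(`mem_annulusOpenCrossing_of_traversal`, `dualConfig_mem_annulusOpenCrossing_of_traversal`, on
top of the tree's `left_step_of_untainted` / `right_step_of_untainted` and
`mem_annulusOpenCrossing_of_fin_chain`).  Sites of a discrete arc whose continuous arc is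
Hausdorff-close to a set `K` are far from boundary points far from `K`
(`dist_meshPoint_ge_of_mem_zdDiscreteArc`); a curve starting far from `z` and visiting
`B̄(z, ρ')` traverses `D(z; ρ', R)` inside `B̄(z, R)` (`exists_isTraversal_of_visit`, tight
crossing times).  Assembly: `arm_of_visit`.

References: M. Aizenman, A. Burchard, Duke Math. J. 99 (1999), App. A (arms bordering a
traversal of a shell by the interface); S. Smirnov, C. R. Acad. Sci. 333 (2001) §2 (open edges
on the left, dual-open on the right of the exploration path).
-/

noncomputable section

open MeasureTheory Filter Set Topology Metric
open scoped unitInterval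
open Literature.Probability.Percolation Literature.Probability.LatticeModels
open Literature.Probability.RandomPlanarGeometry
open Literature.Probability.LatticeModels.IsMedialExploration

namespace Summit.CriticalPhenomena.CardyFormulaZ2.Cruxes.LagHandOff.HittingTournament

/-! ### One clean traversal of a shell by the exploration polygon gives a genuine arm -/

section Arms

variable {D' : DiscreteDobrushin} {ω : BondConfig (Site 2)} {a : MedialVertex}
  {l : List MedialVertex}

/-- `tIdx` is a valid dart index (general discrete Dobrushin data). -/
theorem tIdx_lt_length (hexp : IsMedialExploration D' ω (a :: l)) (u : I) :
    tIdx l u < ((a :: l).zip l).length := by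
  have hl : l ≠ [] := by
    intro h; subst h; exact hexp.head_ne_getLast rfl
  have : 0 < l.length := List.length_pos_iff.2 hl
  rw [IsMedialExploration.length_zip]; unfold tIdx; omega

/-- The polygon is within `δ` of the left vertex of its current dart (general data). -/
theorem dist_polyline_cv_le' (hexp : IsMedialExploration D' ω (a :: l)) (hδ : 0 ≤ D'.δ)
    (u : I) :
    dist (polyline ((a :: l).map (medialPoint D'.δ)) u) (meshPoint D'.δ (hexp.cv (tIdx l u))) ≤
      D'.δ :=
  hexp.dist_polyline_meshPoint_le hδ (fun _ hi => hexp.isCorner hi)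
    (fun _ hi => (hexp.corner_spec hi).2.2.1) (fun _ hi => (hexp.corner_spec hi).2.2.2) u

/-- The polygon is within `3δ` of the reference corner of the right face of its current dart. -/
theorem dist_polyline_cf_le' (hexp : IsMedialExploration D' ω (a :: l)) (hδ : 0 ≤ D'.δ)
    (u : I) :
    dist (polyline ((a :: l).map (medialPoint D'.δ)) u) (meshPoint D'.δ (hexp.cf (tIdx l u))) ≤
      3 * D'.δ := by
  have h1 := dist_polyline_cv_le' hexp hδ u
  have h2 := dist_meshPoint_le_of_isCorner hδ (hexp.isCorner (tIdx_lt_length hexp u))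
  linarith [dist_triangle (polyline ((a :: l).map (medialPoint D'.δ)) u)
    (meshPoint D'.δ (hexp.cv (tIdx l u))) (meshPoint D'.δ (hexp.cf (tIdx l u)))]

/-- **A traversal whose left vertices avoid the wired arc gives an open arm of `ω` itself.**
If the exploration polygon traverses the shell `D(x; ρ, R)` between the times `s ≤ t` and no
left vertex of the darts traversed in between lies on the discrete arc `A`, then `ω` contains an
open crossing of the annulus `A(x; ρ + δ, R - δ)` (the left chain, `left_step_of_untainted`). -/
theorem mem_annulusOpenCrossing_of_traversal (hexp : IsMedialExploration D' ω (a :: l))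
    (hδ : 0 < D'.δ) {x : ℂ} {ρ R : ℝ} (hρR : ρ ≤ R) {s t : I}
    (htr : (⟨polyline ((a :: l).map (medialPoint D'.δ))⟩ : Curve ℂ).IsTraversal x ρ R s t)
    (hA : ∀ i, tIdx l s < i → i ≤ tIdx l t → hexp.cv i ∉ D'.zdArcA) :
    ω ∈ annulusOpenCrossing x D'.δ (ρ + D'.δ) (R - D'.δ) := by
  have hi₀₁ : tIdx l s ≤ tIdx l t := tIdx_mono l htr.1
  have hi₁ : tIdx l t < ((a :: l).zip l).length := tIdx_lt_length hexp t
  have hcurve : ∀ u, (⟨polyline ((a :: l).map (medialPoint D'.δ))⟩ : Curve ℂ) u =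
      polyline ((a :: l).map (medialPoint D'.δ)) u := fun u => rfl
  have hmem : ω ∩ (zdGraph 2).edgeSet ∈ annulusOpenCrossing x D'.δ (ρ + D'.δ) (R - D'.δ) := by
    refine mem_annulusOpenCrossing_of_fin_chain hδ.le (by linarith) (fun v w h => ?_)
      (N := tIdx l t - tIdx l s) (fun j => hexp.cv (tIdx l s + j)) (fun j hj => ?_) ?_
    · rw [dist_meshPoint_of_adj ((SimpleGraph.mem_edgeSet _).1 h.2), abs_of_pos hδ]
    · have hj' : tIdx l s + j + 1 ≤ tIdx l t := by have := j.2; omega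
      rcases left_step_of_untainted hexp (i := tIdx l s + j + 1) (by omega) (by omega)
        (hA _ (by omega) hj') with h | ⟨h, hadj⟩
      · left; simpa [Nat.add_sub_cancel, add_assoc] using h
      · right
        simp only [Nat.add_sub_cancel] at h hadj
        refine ⟨?_, (SimpleGraph.mem_edgeSet _).2 ?_⟩
        · simpa [add_assoc] using h
        · simpa [add_assoc] using hadj
    · have hs' := dist_polyline_cv_le' hexp hδ.le s
      have ht' := dist_polyline_cv_le' hexp hδ.le t
      simp only [Fin.val_zero, add_zero, Fin.val_last, Nat.add_sub_cancel' hi₀₁]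
      have h1 := dist_triangle (meshPoint D'.δ (hexp.cv (tIdx l s)))
        (polyline ((a :: l).map (medialPoint D'.δ)) s) x
      have h2 := dist_triangle (polyline ((a :: l).map (medialPoint D'.δ)) t)
        (meshPoint D'.δ (hexp.cv (tIdx l t))) x
      have h3 := dist_triangle (polyline ((a :: l).map (medialPoint D'.δ)) s)
        (meshPoint D'.δ (hexp.cv (tIdx l s))) x
      have h4 := dist_triangle (meshPoint D'.δ (hexp.cv (tIdx l t)))
        (polyline ((a :: l).map (medialPoint D'.δ)) t) x
      have hs'' := hs'
      rw [dist_comm] at hs''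
      have ht'' := ht'
      rw [dist_comm] at ht''
      rcases htr.2 with ⟨hin, hout⟩ | ⟨hout, hin⟩ <;> rw [hcurve] at hin hout
      · left; constructor <;> linarith
      · right; constructor <;> linarith
  exact isUpperSet_annulusOpenCrossing x _ _ _ inter_subset_left hmem

/-- **A traversal whose right faces avoid the dual-wired arc gives a dual-open arm of
`dualConfig ω` itself.** If the exploration polygon traverses `D(x; ρ, R)` between `s ≤ t`
(`ρ + 4δ ≤ R`) and no corner of a right face of the darts traversed in between lies on the
discrete arc `B`, then `dualConfig ω` contains an open crossing of `A(x; ρ + 3δ, R - 3δ)`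
(the right chain, `right_step_of_untainted`). -/
theorem dualConfig_mem_annulusOpenCrossing_of_traversal (hexp : IsMedialExploration D' ω (a :: l))
    (hδ : 0 < D'.δ) {x : ℂ} {ρ R : ℝ} (hρR : ρ + 4 * D'.δ ≤ R) {s t : I}
    (htr : (⟨polyline ((a :: l).map (medialPoint D'.δ))⟩ : Curve ℂ).IsTraversal x ρ R s t)
    (hB : ∀ i, tIdx l s ≤ i → i < tIdx l t → ∀ u', IsCorner u' (hexp.cf i) → u' ∉ D'.zdArcB) :
    dualConfig ω ∈ annulusOpenCrossing x D'.δ (ρ + 3 * D'.δ) (R - 3 * D'.δ) := by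
  have hi₀₁ : tIdx l s ≤ tIdx l t := tIdx_mono l htr.1
  have hi₁ : tIdx l t < ((a :: l).zip l).length := tIdx_lt_length hexp t
  have hcurve : ∀ u, (⟨polyline ((a :: l).map (medialPoint D'.δ))⟩ : Curve ℂ) u =
      polyline ((a :: l).map (medialPoint D'.δ)) u := fun u => rfl
  refine mem_annulusOpenCrossing_of_fin_chain hδ.le (by linarith) (fun v w h => ?_)
    (N := tIdx l t - tIdx l s) (fun j => hexp.cf (tIdx l s + j)) (fun j hj => ?_) ?_
  · rw [dist_meshPoint_of_adj ((SimpleGraph.mem_edgeSet _).1 (mem_dualConfig_iff.1 h).1),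
      abs_of_pos hδ]
  · have hj' : tIdx l s + j + 1 ≤ tIdx l t := by have := j.2; omega
    rcases right_step_of_untainted hexp (i := tIdx l s + j + 1) (by omega) (by omega)
      (by simpa only [Nat.add_sub_cancel] using hB (tIdx l s + j) (by omega) (by omega))
      with h | h
    · left; simpa [Nat.add_sub_cancel, add_assoc] using h
    · right
      simp only [Nat.add_sub_cancel] at h
      simpa [add_assoc] using h
  · have hs' := dist_polyline_cf_le' hexp hδ.le s
    have ht' := dist_polyline_cf_le' hexp hδ.le t
    simp only [Fin.val_zero, add_zero, Fin.val_last, Nat.add_sub_cancel' hi₀₁]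
    have h1 := dist_triangle (meshPoint D'.δ (hexp.cf (tIdx l s)))
      (polyline ((a :: l).map (medialPoint D'.δ)) s) x
    have h2 := dist_triangle (polyline ((a :: l).map (medialPoint D'.δ)) t)
      (meshPoint D'.δ (hexp.cf (tIdx l t))) x
    have h3 := dist_triangle (polyline ((a :: l).map (medialPoint D'.δ)) s)
      (meshPoint D'.δ (hexp.cf (tIdx l s))) x
    have h4 := dist_triangle (meshPoint D'.δ (hexp.cf (tIdx l t)))
      (polyline ((a :: l).map (medialPoint D'.δ)) t) x
    have hs'' := hs'
    rw [dist_comm] at hs''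
    have ht'' := ht'
    rw [dist_comm] at ht''
    rcases htr.2 with ⟨hin, hout⟩ | ⟨hout, hin⟩ <;> rw [hcurve] at hin hout
    · left; constructor <;> linarith
    · right; constructor <;> linarith

/-- **Localisation of the taint hypotheses.** If during `[s, t]` the polygon stays in the
closed disc `B̄(x, R₀)` and every site of `S` has its mesh point at distance `> R₀ + 5δ` from
`x`, then no left vertex and no corner of a right face of the darts traversed in between lies in
`S`. -/
theorem forall_corner_not_mem_of_far (hexp : IsMedialExploration D' ω (a :: l))
    (hδ : 0 ≤ D'.δ) {x : ℂ} {R₀ : ℝ} {s t : I} (hst : s ≤ t)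
    (hin : ∀ u, s ≤ u → u ≤ t → dist (polyline ((a :: l).map (medialPoint D'.δ)) u) x ≤ R₀)
    {S : Set (Site 2)} (hS : ∀ v ∈ S, R₀ + 5 * D'.δ < dist (meshPoint D'.δ v) x) :
    (∀ i, tIdx l s ≤ i → i ≤ tIdx l t → hexp.cv i ∉ S) ∧
      ∀ i, tIdx l s ≤ i → i ≤ tIdx l t → ∀ u', IsCorner u' (hexp.cf i) → u' ∉ S := by
  have key : ∀ i, tIdx l s ≤ i → i ≤ tIdx l t →
      dist (meshPoint D'.δ (hexp.cv i)) x ≤ R₀ + D'.δ ∧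
        ∀ u', IsCorner u' (hexp.cf i) → dist (meshPoint D'.δ u') x ≤ R₀ + 5 * D'.δ := by
    intro i h0 h1
    obtain ⟨u, hsu, hut, hu⟩ := exists_time_of_tIdx l hst h0 h1
    have hd := dist_polyline_cv_le' hexp hδ u
    rw [hu] at hd
    have hux := hin u hsu hut
    have hcv : dist (meshPoint D'.δ (hexp.cv i)) x ≤ R₀ + D'.δ := by
      linarith [dist_triangle (meshPoint D'.δ (hexp.cv i))
        (polyline ((a :: l).map (medialPoint D'.δ)) u) x,
        dist_comm (polyline ((a :: l).map (medialPoint D'.δ)) u) (meshPoint D'.δ (hexp.cv i))]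
    refine ⟨hcv, fun u' hu' => ?_⟩
    have hi : i < ((a :: l).zip l).length := h1.trans_lt (tIdx_lt_length hexp t)
    have h2 := dist_meshPoint_le_of_isCorner hδ (hexp.isCorner hi)
    have h3 := dist_meshPoint_le_of_isCorner hδ hu'
    linarith [dist_triangle (meshPoint D'.δ u') (meshPoint D'.δ (hexp.cf i)) x,
      dist_triangle (meshPoint D'.δ (hexp.cf i)) (meshPoint D'.δ (hexp.cv i)) x,
      dist_comm (meshPoint D'.δ (hexp.cv i)) (meshPoint D'.δ (hexp.cf i))]
  refine ⟨fun i h0 h1 hmem => ?_, fun i h0 h1 u' hu' hmem => ?_⟩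
  · have := hS _ hmem
    have := (key i h0 h1).1
    linarith
  · have := hS _ hmem
    have := (key i h0 h1).2 u' hu'
    linarith

end Arms

/-! ### Discrete arcs of a discretisation family stay away from interior points of the other arc -/

section Family

/-- **Sites of a discrete arc are far from boundary points far from its continuous arc.** If
the continuous arc `A'` of the data is Hausdorff-`η`-close to a nonempty set `K`, every point of
which is at distance `≥ r > η` from a point `z` of `∂Ω`, then every site of the discrete arc
`zdDiscreteArc A'` has its mesh point at distance `≥ (r - η)/2` from `z` (such a site is at
least as close to `A'` as to `∂Ω ∖ A' ∋ z`). -/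
theorem dist_meshPoint_ge_of_mem_zdDiscreteArc {D' : DiscreteDobrushin} {A' K : Set ℂ}
    (hK : K.Nonempty) {η r : ℝ} (hH : hausdorffEDist A' K < ENNReal.ofReal η) {z : ℂ}
    (hz : z ∈ frontier D'.Ω) (hηr : η < r) (hzK : ∀ q ∈ K, r ≤ dist z q) {v : Site 2}
    (hv : v ∈ D'.zdDiscreteArc A') : (r - η) / 2 ≤ dist (meshPoint D'.δ v) z := by
  set p := meshPoint D'.δ v with hp
  have hA'ne : A'.Nonempty := by
    by_contra h
    rw [not_nonempty_iff_eq_empty] at h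
    rw [h, hausdorffEDist_comm, hausdorffEDist_empty hK] at hH
    exact absurd hH (not_lt.2 le_top)
  have hfin : hausdorffEDist A' K ≠ ⊤ := ne_top_of_lt hH
  have hHd : hausdorffDist A' K < η := by
    rw [hausdorffDist, ← ENNReal.lt_ofReal_iff_toReal_lt hfin]
    exact hH
  -- `z` is not on `A'`
  have hzA : z ∉ A' := by
    intro hzA
    obtain ⟨q, hq, hzq⟩ := exists_edist_lt_of_hausdorffEDist_lt hzA hH
    rw [edist_lt_ofReal] at hzq
    have := hzK q hq
    linarith
  -- compare the defining inequality of the discrete arc with the distances to `K` and `z`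
  have h1 : infDist p A' ≤ dist p z :=
    hv.2.trans (infDist_le_dist_of_mem ⟨hz, hzA⟩)
  have h2 : infDist p K ≤ infDist p A' + hausdorffDist A' K :=
    infDist_le_infDist_add_hausdorffDist hfin
  have h3 : infDist z K ≤ infDist p K + dist z p := infDist_le_infDist_add_dist
  have h4 : r ≤ infDist z K := by
    by_contra h
    obtain ⟨q, hq, hzq⟩ := (infDist_lt_iff hK).1 (not_le.1 h)
    have := hzK q hq
    linarith
  rw [dist_comm z p] at h3
  linarith

/-- **Tight traversals.** If a continuous curve starts at distance `≥ R` from `z` and visits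
the closed disc `B̄(z, ρ')`, `ρ' < R`, then some segment of it traverses the shell
`D(z; ρ', R)` while staying in `B̄(z, R)`. -/
theorem exists_isTraversal_of_visit (c : C(I, ℂ)) {z : ℂ} {ρ' R : ℝ} (hρ'R : ρ' < R)
    (h0 : R ≤ dist (c 0) z) {u₀ : I} (hu₀ : dist (c u₀) z ≤ ρ') :
    ∃ s t : I, (⟨c⟩ : Curve ℂ).IsTraversal z ρ' R s t ∧
      ∀ u, s ≤ u → u ≤ t → dist (c u) z ≤ R := by
  obtain ⟨s, t, -, hst, -, hs, ht, hbetween⟩ :=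
    exists_tight_crossing' (f := fun u => dist (c u) z) (c.continuous.dist continuous_const)
      (s := 0) (t := u₀) bot_le hρ'R h0 hu₀
  exact ⟨s, t, ⟨hst.le, Or.inr ⟨hs.ge, ht.le⟩⟩, fun u hsu hut => (hbetween u hsu hut).2⟩

/-- **One visit near a boundary point forces an arm, at a fixed mesh.** Let the admissible data
`D'` (mesh `δ ≤ r/64`) have both discrete marked points at distance `≥ 3r/4` from a point `z`,
and all sites of its discrete arc `A` — or all sites of its discrete arc `B` — at distance
`≥ 3r/8` from `z`.  If the exploration polygon of `ω` visits `B̄(z, ρ')` with `2ρ' ≤ r/8`, then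
`ω` contains an open crossing of `A(z; ρ' + δ, r/8 - δ)` or `dualConfig ω` an open (i.e.
`ω`-closed) crossing of `A(z; ρ' + 3δ, r/8 - 3δ)`. -/
theorem stub_noTrace_armOfVisit :
    ∀ (D' : DiscreteDobrushin), D'.IsZdAdmissible → ∀ (z : ℂ) (r : ℝ), D'.δ ≤ r / 64 →
      (∀ p ∈ medialPoint D'.δ '' D'.zdABEdges, 3 * r / 4 ≤ dist p z) →
      ((∀ v ∈ D'.zdArcA, 3 * r / 8 ≤ dist (meshPoint D'.δ v) z) ∨
        (∀ v ∈ D'.zdArcB, 3 * r / 8 ≤ dist (meshPoint D'.δ v) z)) →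
      ∀ (ρ' : ℝ), 2 * ρ' ≤ r / 8 → ∀ (ω : BondConfig (Site 2)),
        (∃ u, dist (medialExplorationCurve D' ω u) z ≤ ρ') →
          ω ∈ annulusOpenCrossing z D'.δ (ρ' + D'.δ) (r / 8 - D'.δ) ∨
            dualConfig ω ∈ annulusOpenCrossing z D'.δ (ρ' + 3 * D'.δ) (r / 8 - 3 * D'.δ) := by
  intro D' hadm z r hδr hends hside ρ' hρ'r ω hvisit
  have hδ : 0 < D'.δ := hadm.delta_pos
  have hγ := isMedialExploration_medialExploration_holds D' hadm ω
  obtain ⟨a, l, hal⟩ := List.exists_cons_of_ne_nil hγ.ne_nil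
  rw [hal] at hγ
  have hcurve_eq : medialExplorationCurve D' ω = polyline ((a :: l).map (medialPoint D'.δ)) := by
    rw [medialExplorationCurve, hal]
  obtain ⟨u₀, hu₀⟩ := hvisit
  rw [hcurve_eq] at hu₀
  -- the polygon starts at the discrete marked point, far from `z`
  have h0 : r / 8 ≤ dist (polyline ((a :: l).map (medialPoint D'.δ)) 0) z := by
    rw [List.map_cons, polyline_apply_zero]
    have := hends _ ⟨a, hγ.head_mem, rfl⟩
    linarith
  obtain ⟨s, t, htr, hin⟩ := exists_isTraversal_of_visit
    (polyline ((a :: l).map (medialPoint D'.δ))) (by linarith : ρ' < r / 8) h0 hu₀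
  rcases hside with hA | hB
  · left
    have hfar := (forall_corner_not_mem_of_far hγ hδ.le htr.1 hin (S := D'.zdArcA)
      (fun v hv => by have := hA v hv; linarith)).1
    exact mem_annulusOpenCrossing_of_traversal hγ hδ (by linarith) htr
      (fun i h0' h1' => hfar i h0'.le h1')
  · right
    have hfar := (forall_corner_not_mem_of_far hγ hδ.le htr.1 hin (S := D'.zdArcB)
      (fun v hv => by have := hB v hv; linarith)).2
    exact dualConfig_mem_annulusOpenCrossing_of_traversal hγ hδ (by linarith) htr
      (fun i h0' h1' => hfar i h0' h1'.le)

/-- `stub_noTrace_armOfVisit` with implicit arguments. -/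
theorem arm_of_visit {D' : DiscreteDobrushin} (hadm : D'.IsZdAdmissible) {z : ℂ} {r : ℝ}
    (hδr : D'.δ ≤ r / 64)
    (hends : ∀ p ∈ medialPoint D'.δ '' D'.zdABEdges, 3 * r / 4 ≤ dist p z)
    (hside : (∀ v ∈ D'.zdArcA, 3 * r / 8 ≤ dist (meshPoint D'.δ v) z) ∨
      (∀ v ∈ D'.zdArcB, 3 * r / 8 ≤ dist (meshPoint D'.δ v) z))
    {ρ' : ℝ} (hρ'r : 2 * ρ' ≤ r / 8) {ω : BondConfig (Site 2)}
    (hvisit : ∃ u, dist (medialExplorationCurve D' ω u) z ≤ ρ') :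
    ω ∈ annulusOpenCrossing z D'.δ (ρ' + D'.δ) (r / 8 - D'.δ) ∨
      dualConfig ω ∈ annulusOpenCrossing z D'.δ (ρ' + 3 * D'.δ) (r / 8 - 3 * D'.δ) :=
  stub_noTrace_armOfVisit D' hadm z r hδr hends hside ρ' hρ'r ω hvisit

end Family

end Summit.CriticalPhenomena.CardyFormulaZ2.Cruxes.LagHandOff.HittingTournament

end
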